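import Summits.ResolutionOfSingularities.ResolutionOfSingularities.Theorems.PurelyInseparableDim4SwapTransportWindowStepSigma
import Summits.ResolutionOfSingularities.ResolutionOfSingularities.Theorems.PurelyInseparableDim4FreeTail
import HarnessLib
import HarnessLib.Audit.Tags

/-!
# Purely inseparable four-folds — THE VIRTUAL WINDOW FOLLOWS THE REAL CHAIN FOR EVERY σ = (n, n) + 0: one real step of ANY kind is shadowed,
# and the shadow iterates through `T` steps (cell `res-dim4-pi`, K2(p) lane, B-LF (iii-b) class (iii), virtual port 1 ↦ n of the C∞ window,
# FILE I1 = W5a p716901 with `1 ↦ n`)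

[OURS · counted 0 · cell `res-dim4-pi` · K2(p) lane (holder res-dim4-p-12 g5, ruling g5-21 (α)).]  Nothing here proves K2(p) for any `p`, any
TAIL(p, d, 3), `NoIsolatedTrap p p` or resolution of singularities in dimension ≥ 4 / characteristic `p` — NOT proved.  AI kernel work,
weaker than expert review.  Transport bookkeeping about OUR frame; kills nothing by itself.

W5a VERBATIM WITH `1 ↦ n` over S1 (`virtual_step_slot/rotate_sigma0`) and G1 (`step_cases_of_weights_sigma0`):
* §1 **`virtual_step_any_sigma0`** — one real step of any kind (slot step in either slot chart, or rotation through either free letter dropping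
  either slot) is shadowed by the pure virtual slot step in the chart `ℓ = if jr = π λ then λ else if jr = π μ then μ else (the dropped
  slot)`, with the new bijection `π⁺`; precision `M ≥ Nc + 2p + n + 1`, jet `N ≥ p + n + 2`.
* §2 **`virtual_iterate_sigma0`** — the shadow follows the real chain for `T` steps (budgets `Nc + 2p + n + 1 + p·T ≤ M`,
  `p + n + 2 + d·T ≤ N`; at step `t` the precision is `M − p·t` and the jet `N − d·t`).
[cite: Hauser2010, §§F–G] [cite: CossartJannsenSaito2020, Thm. 3.14, Lemma 13.2]
bears_on: LADDER-RESOLUTION:D157-DOOR2 (res-dim4-pi · K2(p) B-LF (iii-b) class (iii) virtual port I1).  Supports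
stmt-ResolutionOfSingularities-16155 (helper).
-/

set_option linter.dupNamespace false -- mandated namespace of this single-conjunct summit

noncomputable section

namespace Summit.ResolutionOfSingularities.ResolutionOfSingularities.Theorems.PIDim4

namespace SwapTransport

open MvPolynomial Finset
open Literature.AlgebraicGeometry.Resolution
open Literature.AlgebraicGeometry.Resolution.CentreBlowup
open Literature.AlgebraicGeometry.Resolution.Hauser2010
open Literature.AlgebraicGeometry.Resolution.HauserPerlega2019

variable {K : Type} [Field K] [DecidableEq K]

/-! ## §1 One real step of any kind, every prime -/

/-- **ONE REAL STEP OF ANY KIND, SHADOWED, every prime** (see the module docstring, §1). [OURS] [cite: Hauser2010, §§F–G]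
[cite: CossartJannsenSaito2020, Thm. 3.14] -/
theorem virtual_step_any_sigma0 (p : ℕ) [Fact p.Prime] [CharP K p] {n d : ℕ} (hσ : n + d = p) (hn : 0 < n) (hd2 : 2 ≤ d) {eu ef : ℕ}
    (hef : eu + ef = d - 2) {la mu u f : Fin 4} (hlm : la ≠ mu) (hlu : la ≠ u) (hlf : la ≠ f) (hmu : mu ≠ u) (hmf : mu ≠ f) (huf : u ≠ f)
    {π : Equiv.Perm (Fin 4)} {A B : State K} {M N Nc : ℕ}
    (hrel : ∃ (θ e : Fin 4 → MvPolynomial (Fin 4) K) (U E : MvPolynomial (Fin 4) K),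
      θ (π la) = X la * e la ∧ θ (π mu) = X mu * e mu ∧ constantCoeff (e la) ≠ 0 ∧ constantCoeff (e mu) ≠ 0 ∧
      constantCoeff (θ (π u)) = 0 ∧ constantCoeff (θ (π f)) = 0 ∧
      coeff (Finsupp.single u 1) (θ (π u)) * coeff (Finsupp.single f 1) (θ (π f)) -
        coeff (Finsupp.single f 1) (θ (π u)) * coeff (Finsupp.single u 1) (θ (π f)) ≠ 0 ∧
      constantCoeff U ≠ 0 ∧ E ∈ originIdeal K ^ M ∧ B.F = deletePthPowers p (U ^ p * aeval θ A.F) + E)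
    (hrA : A.r = Finsupp.single (π la) n + Finsupp.single (π mu) n) (hoA : ordZero A.F = ((p + n : ℕ) : ℕ∞))
    (hfr : ordZero B.F = ((p + n : ℕ) : ℕ∞) ∧ B.r = Finsupp.single la n + Finsupp.single mu n ∧
      (∀ e ∈ B.F.support, B.r ≤ e) ∧ (∃ a : K, a ≠ 0 ∧ ResCone.resForm B = C a * X f ^ d) ∧
      (∀ e ∈ B.F.support, e f ≤ d - 1 → n + 1 ≤ e la ∧ n + 1 ≤ e mu) ∧
      (∀ e ∈ B.F.support, e.degree < N → ¬ (e u = eu ∧ e f = ef)) ∧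
      coeff (B.r + (Finsupp.single la 1 + Finsupp.single mu 1 + Finsupp.single u (eu + 1) + Finsupp.single f ef)) B.F ≠ 0 ∧
      IsIsolated p B.F ∧ Module.finrank K (ResCone.resVertex B) = 3)
    {jr : Fin 4} {b : Fin 4 → K} (hbj : b jr = 0) {A' : State K} (hstep : A' = CentreBlowup.step p Finset.univ jr b A)
    (hisoA' : IsIsolated p A'.F) (hcert : originIdeal K ^ Nc ≤ singLocusIdeal p A'.F ⊔ originIdeal K ^ (Nc + 1))
    (hoA' : ordZero A'.F = ((p + n : ℕ) : ℕ∞)) (he3A' : Module.finrank K (ResCone.resVertex A') = 3)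
    (hdegA' : A'.r.degree = 2 * n) (hdivA' : ∀ e ∈ A'.F.support, A'.r ≤ e) (hM : Nc + 2 * p + n + 1 ≤ M)
    (hN : p + n + 2 ≤ N) :
    ∃ (ℓ : Fin 4) (π' : Equiv.Perm (Fin 4)), (ℓ = la ∨ ℓ = mu) ∧
      (ℓ = if jr = π la then la else if jr = π mu then mu else if b (π la) ≠ 0 then la else mu) ∧
      (π' = if jr = π la ∨ jr = π mu then π else (Equiv.swap ℓ (π.symm jr)).trans π) ∧
      (∃ (θ' e' : Fin 4 → MvPolynomial (Fin 4) K) (U' E' : MvPolynomial (Fin 4) K),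
        θ' (π' la) = X la * e' la ∧ θ' (π' mu) = X mu * e' mu ∧ constantCoeff (e' la) ≠ 0 ∧ constantCoeff (e' mu) ≠ 0 ∧
        constantCoeff (θ' (π' u)) = 0 ∧ constantCoeff (θ' (π' f)) = 0 ∧
        coeff (Finsupp.single u 1) (θ' (π' u)) * coeff (Finsupp.single f 1) (θ' (π' f)) -
          coeff (Finsupp.single f 1) (θ' (π' u)) * coeff (Finsupp.single u 1) (θ' (π' f)) ≠ 0 ∧
        constantCoeff U' ≠ 0 ∧ E' ∈ originIdeal K ^ (M - p) ∧
        (CentreBlowup.step p Finset.univ ℓ 0 B).F = deletePthPowers p (U' ^ p * aeval θ' A'.F) + E') ∧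
      A'.r = Finsupp.single (π' la) n + Finsupp.single (π' mu) n ∧
      (ordZero (CentreBlowup.step p Finset.univ ℓ 0 B).F = ((p + n : ℕ) : ℕ∞) ∧
        (CentreBlowup.step p Finset.univ ℓ 0 B).r = Finsupp.single la n + Finsupp.single mu n ∧
        (∀ e ∈ (CentreBlowup.step p Finset.univ ℓ 0 B).F.support, (CentreBlowup.step p Finset.univ ℓ 0 B).r ≤ e) ∧
        (∃ a : K, a ≠ 0 ∧ ResCone.resForm (CentreBlowup.step p Finset.univ ℓ 0 B) = C a * X f ^ d) ∧
        (∀ e ∈ (CentreBlowup.step p Finset.univ ℓ 0 B).F.support, e f ≤ d - 1 → n + 1 ≤ e la ∧ n + 1 ≤ e mu) ∧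
        (∀ e ∈ (CentreBlowup.step p Finset.univ ℓ 0 B).F.support, e.degree < N - d → ¬ (e u = eu ∧ e f = ef)) ∧
        coeff ((CentreBlowup.step p Finset.univ ℓ 0 B).r +
          (Finsupp.single la 1 + Finsupp.single mu 1 + Finsupp.single u (eu + 1) + Finsupp.single f ef)) (CentreBlowup.step p Finset.univ ℓ 0 B).F ≠ 0 ∧
        IsIsolated p (CentreBlowup.step p Finset.univ ℓ 0 B).F ∧
        Module.finrank K (ResCone.resVertex (CentreBlowup.step p Finset.univ ℓ 0 B)) = 3) := by
  obtain ⟨θ, e, U, E, hθa, hθa', hea, hea', hu0, hf0, hdet, hU, hE, hrelF⟩ := hrel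
  obtain ⟨hoB, hrB, hdivB, ⟨a, ha, hformB⟩, hledB, hrowB, hVB, -, -⟩ := hfr
  have hπlm : π la ≠ π mu := fun h => hlm (π.injective h)
  have hπlu : π la ≠ π u := fun h => hlu (π.injective h)
  have hπlf : π la ≠ π f := fun h => hlf (π.injective h)
  have hπmu : π mu ≠ π u := fun h => hmu (π.injective h)
  have hπmf : π mu ≠ π f := fun h => hmf (π.injective h)
  have hπuf : π u ≠ π f := fun h => huf (π.injective h)
  have hdeg' : (CentreBlowup.step p Finset.univ jr b A).r.degree = 2 * n := by rw [← hstep]; exact hdegA'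
  -- the swapped-orientation copies of the inputs
  have hrAs : A.r = Finsupp.single (π mu) n + Finsupp.single (π la) n := by rw [hrA, add_comm]
  have hrBs : B.r = Finsupp.single mu n + Finsupp.single la n := by rw [hrB, add_comm]
  have hledBs : ∀ e ∈ B.F.support, e f ≤ d - 1 → n + 1 ≤ e mu ∧ n + 1 ≤ e la := fun e he hf => (hledB e he hf).symm
  have hVBs : coeff (B.r + (Finsupp.single mu 1 + Finsupp.single la 1 + Finsupp.single u (eu + 1) + Finsupp.single f ef)) B.F ≠ 0 := by
    rw [add_comm (Finsupp.single mu 1) (Finsupp.single la 1)]; exact hVB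
  rcases step_cases_of_weights_sigma0 p hn hπlm hπlu hπlf hπmu hπmf hπuf hrA hoA (jr := jr) (b := b) hdeg' with
    ⟨hjr, hbmu, -⟩ | ⟨hjr, hbla, -⟩ | ⟨hjr, hrot⟩
  · -- slot step in the chart of `π λ`
    subst hjr
    obtain ⟨-, hrA', θ', e', U', E', h1, h2, h3, h4, h5, h6, h7, h8, h9, h10, hfr'⟩ :=
      virtual_step_slot_sigma0 p hσ hn hd2 hlm hlu hlf hmu hmf huf hθa hθa' hea hea' hu0 hf0 hdet hU hE hrelF hoA hrA hbj hstep
        hisoA' hcert hoA' he3A' hdegA' hdivA' hoB hrB hdivB ha hformB hledB hef hN hrowB hVB hM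
    refine ⟨la, π, Or.inl rfl, by rw [if_pos rfl], by rw [if_pos (Or.inl rfl)], ⟨θ', e', U', E', h1, h2, h3, h4, h5, h6, h7, h8,
      h9, h10⟩, hrA', hfr'⟩
  · -- slot step in the chart of `π μ`
    subst hjr
    obtain ⟨-, hrA', θ', e', U', E', h1, h2, h3, h4, h5, h6, h7, h8, h9, h10, ho', hr', hdiv', hform', hled', hrow', hV',
      hiso', he3'⟩ :=
      virtual_step_slot_sigma0 p hσ hn hd2 hlm.symm hmu hmf hlu hlf huf hθa' hθa hea' hea hu0 hf0 hdet hU hE hrelF hoA hrAs hbj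
        hstep hisoA' hcert hoA' he3A' hdegA' hdivA' hoB hrBs hdivB ha hformB hledBs hef hN hrowB hVBs hM
    refine ⟨mu, π, Or.inr rfl, by rw [if_neg hπlm.symm, if_pos rfl], by rw [if_pos (Or.inr rfl)], ⟨θ', e', U', E', h2, h1,
      h4, h3, h5, h6, h7, h8, h9, h10⟩, by rw [hrA', add_comm], ho', by rw [hr', add_comm], hdiv', hform',
      fun e he hf => (hled' e he hf).symm, hrow', ?_, hiso', he3'⟩
    rw [add_comm (Finsupp.single la 1) (Finsupp.single mu 1)]; exact hV'
  · -- rotation through the free letter `jr = π g`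
    have hjl : jr ≠ π la := by rcases hjr with rfl | rfl <;> [exact hπlu.symm; exact hπlf.symm]
    have hjm : jr ≠ π mu := by rcases hjr with rfl | rfl <;> [exact hπmu.symm; exact hπmf.symm]
    -- the free letter `g` with `jr = π g`, and its partner
    obtain ⟨g, gt, hg, hjg⟩ : ∃ g gt : Fin 4, ((g = u ∧ gt = f) ∨ (g = f ∧ gt = u)) ∧ jr = π g := by
      rcases hjr with h | h
      · exact ⟨u, f, Or.inl ⟨rfl, rfl⟩, h⟩
      · exact ⟨f, u, Or.inr ⟨rfl, rfl⟩, h⟩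
    subst hjg
    have hsymm : π.symm (π g) = g := π.symm_apply_apply g
    rcases hrot with ⟨hbla, hbmu, hr'⟩ | ⟨hbmu, hbla, hr'⟩
    · -- the slot `π λ` is translated away: virtual chart `λ`
      have hrA'g : A'.r = Finsupp.single (π g) n + Finsupp.single (π mu) n := by rw [hstep, hr']
      obtain ⟨π', θ', e', U', E', hπ', -, -, -, -, h1, h2, h3, h4, h5, h6, h7, h8, h9, h10, hfr'⟩ :=
        virtual_step_rotate_sigma0 p hσ hn hd2 hlm hlu hlf hmu hmf huf hg hθa hθa' hea hea' hu0 hf0 hdet hU hE hrelF hoA hbj hbla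
          hbmu hstep hisoA' hcert hoA' he3A' hrA'g hdivA' hoB hrB hdivB ha hformB hledB hef hN hrowB hVB hM
      have hπ'l : π' la = π g := by rw [hπ', Equiv.trans_apply, Equiv.swap_apply_left]
      have hπ'm : π' mu = π mu := by
        have hmg : mu ≠ g := by rcases hg with ⟨rfl, -⟩ | ⟨rfl, -⟩ <;> [exact hmu; exact hmf]
        rw [hπ', Equiv.trans_apply, Equiv.swap_apply_of_ne_of_ne hlm.symm hmg]
      refine ⟨la, π', Or.inl rfl, by rw [if_neg hjl, if_neg hjm, if_pos hbla], by rw [if_neg (not_or.mpr ⟨hjl, hjm⟩), hsymm, hπ'],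
        ⟨θ', e', U', E', h1, h2, h3, h4, h5, h6, h7, h8, h9, h10⟩, by rw [hrA'g, hπ'l, hπ'm], hfr'⟩
    · -- the slot `π μ` is translated away: virtual chart `μ`
      have hrA'g : A'.r = Finsupp.single (π g) n + Finsupp.single (π la) n := by rw [hstep, hr']
      obtain ⟨π', θ', e', U', E', hπ', -, -, -, -, h1, h2, h3, h4, h5, h6, h7, h8, h9, h10, ho', hr'', hdiv', hform', hled',
        hrow', hV', hiso', he3'⟩ :=
        virtual_step_rotate_sigma0 p hσ hn hd2 hlm.symm hmu hmf hlu hlf huf hg hθa' hθa hea' hea hu0 hf0 hdet hU hE hrelF hoA hbj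
          hbmu hbla hstep hisoA' hcert hoA' he3A' hrA'g hdivA' hoB hrBs hdivB ha hformB hledBs hef hN hrowB hVBs hM
      have hπ'm : π' mu = π g := by rw [hπ', Equiv.trans_apply, Equiv.swap_apply_left]
      have hπ'l : π' la = π la := by
        have hlg : la ≠ g := by rcases hg with ⟨rfl, -⟩ | ⟨rfl, -⟩ <;> [exact hlu; exact hlf]
        rw [hπ', Equiv.trans_apply, Equiv.swap_apply_of_ne_of_ne hlm hlg]
      have hbla' : ¬ b (π la) ≠ 0 := fun h => h hbla
      refine ⟨mu, π', Or.inr rfl, by rw [if_neg hjl, if_neg hjm, if_neg hbla'],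
        by rw [if_neg (not_or.mpr ⟨hjl, hjm⟩), hsymm, hπ'], ⟨θ', e', U', E', h2, h1, h4, h3, h5, h6, h7, h8, h9, h10⟩,
        by rw [hrA'g, hπ'l, hπ'm, add_comm], ho', by rw [hr'', add_comm], hdiv', hform', fun e he hf => (hled' e he hf).symm,
        hrow', ?_, hiso', he3'⟩
      rw [add_comm (Finsupp.single la 1) (Finsupp.single mu 1)]; exact hV'

/-! ## §2 Iteration through any number of real steps, every prime -/

/-- **THE SHADOW FOLLOWS THE REAL CHAIN, every prime** for `T` steps of any kind: the relation (precision `M − p·t`), the real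
ledger along `πs t` and the frame (jet `N − d·t`) at every `t ≤ T`, from an entry at `t = 0` and the virtual data generated by the
recursion rule; budgets `Nc + 2p + 2 + p·T ≤ M`, `d + 4 + d·T ≤ N`. [OURS] [cite: Hauser2010, §§F–G] -/
theorem virtual_iterate_sigma0 (p : ℕ) [Fact p.Prime] [CharP K p] {n d : ℕ} (hσ : n + d = p) (hn : 0 < n) (hd2 : 2 ≤ d) {eu ef : ℕ}
    (hef : eu + ef = d - 2) {la mu u f : Fin 4} (hlm : la ≠ mu) (hlu : la ≠ u) (hlf : la ≠ f) (hmu : mu ≠ u) (hmf : mu ≠ f) (huf : u ≠ f)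
    {c : ℕ → State K} {j : ℕ → Fin 4} {b : ℕ → Fin 4 → K} (hw : FreeTail.IsWitnessedChain p c j b) {k Nc T : ℕ}
    (hisoR : ∀ t, t ≤ T → IsIsolated p (c (k + t)).F)
    (hcert : ∀ t, t ≤ T → originIdeal K ^ Nc ≤ singLocusIdeal p (c (k + t)).F ⊔ originIdeal K ^ (Nc + 1))
    (hoR : ∀ t, t ≤ T → ordZero (c (k + t)).F = ((p + n : ℕ) : ℕ∞))
    (he3R : ∀ t, t ≤ T → Module.finrank K (ResCone.resVertex (c (k + t))) = 3)
    (hwtR : ∀ t, t ≤ T → (c (k + t)).r.degree = 2 * n)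
    (hdivR : ∀ t, t ≤ T → ∀ e ∈ (c (k + t)).F.support, (c (k + t)).r ≤ e)
    {πs : ℕ → Equiv.Perm (Fin 4)} {Bs : ℕ → State K} {ℓs : ℕ → Fin 4}
    (hBs : ∀ t, Bs (t + 1) = CentreBlowup.step p Finset.univ (ℓs t) 0 (Bs t))
    (hℓs : ∀ t, ℓs t = if j (k + t) = πs t la then la else if j (k + t) = πs t mu then mu
      else if b (k + t) (πs t la) ≠ 0 then la else mu)
    (hπs : ∀ t, πs (t + 1) = if j (k + t) = πs t la ∨ j (k + t) = πs t mu then πs t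
      else (Equiv.swap (ℓs t) ((πs t).symm (j (k + t)))).trans (πs t))
    {M N : ℕ} (hM : Nc + 2 * p + n + 1 + p * T ≤ M) (hN : p + n + 2 + d * T ≤ N)
    (hrel0 : ∃ (θ e : Fin 4 → MvPolynomial (Fin 4) K) (U E : MvPolynomial (Fin 4) K),
      θ (πs 0 la) = X la * e la ∧ θ (πs 0 mu) = X mu * e mu ∧ constantCoeff (e la) ≠ 0 ∧ constantCoeff (e mu) ≠ 0 ∧
      constantCoeff (θ (πs 0 u)) = 0 ∧ constantCoeff (θ (πs 0 f)) = 0 ∧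
      coeff (Finsupp.single u 1) (θ (πs 0 u)) * coeff (Finsupp.single f 1) (θ (πs 0 f)) -
        coeff (Finsupp.single f 1) (θ (πs 0 u)) * coeff (Finsupp.single u 1) (θ (πs 0 f)) ≠ 0 ∧
      constantCoeff U ≠ 0 ∧ E ∈ originIdeal K ^ M ∧ (Bs 0).F = deletePthPowers p (U ^ p * aeval θ (c k).F) + E)
    (hrA0 : (c k).r = Finsupp.single (πs 0 la) n + Finsupp.single (πs 0 mu) n)
    (hfr0 : ordZero (Bs 0).F = ((p + n : ℕ) : ℕ∞) ∧ (Bs 0).r = Finsupp.single la n + Finsupp.single mu n ∧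
      (∀ e ∈ (Bs 0).F.support, (Bs 0).r ≤ e) ∧ (∃ a : K, a ≠ 0 ∧ ResCone.resForm (Bs 0) = C a * X f ^ d) ∧
      (∀ e ∈ (Bs 0).F.support, e f ≤ d - 1 → n + 1 ≤ e la ∧ n + 1 ≤ e mu) ∧
      (∀ e ∈ (Bs 0).F.support, e.degree < N → ¬ (e u = eu ∧ e f = ef)) ∧
      coeff ((Bs 0).r + (Finsupp.single la 1 + Finsupp.single mu 1 + Finsupp.single u (eu + 1) + Finsupp.single f ef)) (Bs 0).F ≠ 0 ∧
      IsIsolated p (Bs 0).F ∧ Module.finrank K (ResCone.resVertex (Bs 0)) = 3) :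
    ∀ t, t ≤ T →
      (∃ (θ e : Fin 4 → MvPolynomial (Fin 4) K) (U E : MvPolynomial (Fin 4) K),
        θ (πs t la) = X la * e la ∧ θ (πs t mu) = X mu * e mu ∧ constantCoeff (e la) ≠ 0 ∧ constantCoeff (e mu) ≠ 0 ∧
        constantCoeff (θ (πs t u)) = 0 ∧ constantCoeff (θ (πs t f)) = 0 ∧
        coeff (Finsupp.single u 1) (θ (πs t u)) * coeff (Finsupp.single f 1) (θ (πs t f)) -
          coeff (Finsupp.single f 1) (θ (πs t u)) * coeff (Finsupp.single u 1) (θ (πs t f)) ≠ 0 ∧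
        constantCoeff U ≠ 0 ∧ E ∈ originIdeal K ^ (M - p * t) ∧
        (Bs t).F = deletePthPowers p (U ^ p * aeval θ (c (k + t)).F) + E) ∧
      (c (k + t)).r = Finsupp.single (πs t la) n + Finsupp.single (πs t mu) n ∧
      (ordZero (Bs t).F = ((p + n : ℕ) : ℕ∞) ∧ (Bs t).r = Finsupp.single la n + Finsupp.single mu n ∧
        (∀ e ∈ (Bs t).F.support, (Bs t).r ≤ e) ∧ (∃ a : K, a ≠ 0 ∧ ResCone.resForm (Bs t) = C a * X f ^ d) ∧
        (∀ e ∈ (Bs t).F.support, e f ≤ d - 1 → n + 1 ≤ e la ∧ n + 1 ≤ e mu) ∧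
        (∀ e ∈ (Bs t).F.support, e.degree < N - d * t → ¬ (e u = eu ∧ e f = ef)) ∧
        coeff ((Bs t).r + (Finsupp.single la 1 + Finsupp.single mu 1 + Finsupp.single u (eu + 1) + Finsupp.single f ef)) (Bs t).F ≠ 0 ∧
        IsIsolated p (Bs t).F ∧ Module.finrank K (ResCone.resVertex (Bs t)) = 3) := by
  intro t
  induction t with
  | zero =>
    intro _
    simp only [Nat.mul_zero, Nat.sub_zero, Nat.add_zero]
    exact ⟨hrel0, hrA0, hfr0⟩
  | succ t ih =>
    intro ht
    obtain ⟨hrel, hrA, hfr⟩ := ih (by omega)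
    obtain ⟨-, hbj, -, -, hcs⟩ := hw (k + t)
    have hcs' : c (k + (t + 1)) = CentreBlowup.step p Finset.univ (j (k + t)) (b (k + t)) (c (k + t)) := hcs
    have hpt : p * t + p = p * (t + 1) := (Nat.mul_succ p t).symm
    have hdt : d * t + d = d * (t + 1) := (Nat.mul_succ d t).symm
    have hpT : p * (t + 1) ≤ p * T := Nat.mul_le_mul_left p ht
    have hdT : d * (t + 1) ≤ d * T := Nat.mul_le_mul_left d ht
    obtain ⟨ℓ, π', -, hℓeq, hπ'eq, hrel', hrA', hfr'⟩ := virtual_step_any_sigma0 p hσ hn hd2 hef hlm hlu hlf hmu hmf huf hrel hrA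
      (hoR t (by omega)) hfr hbj hcs' (hisoR (t + 1) ht) (hcert (t + 1) ht) (hoR (t + 1) ht) (he3R (t + 1) ht)
      (hwtR (t + 1) ht) (hdivR (t + 1) ht) (by omega) (by omega)
    have hℓt : ℓs t = ℓ := by rw [hℓs t, hℓeq]
    have hπt : πs (t + 1) = π' := by rw [hπs t, hπ'eq, hℓt]
    have hBt : Bs (t + 1) = CentreBlowup.step p Finset.univ ℓ 0 (Bs t) := by rw [hBs t, hℓt]
    have hM5 : M - p * t - p = M - p * (t + 1) := by omega
    have hN4 : N - d * t - d = N - d * (t + 1) := by omega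
    rw [hπt, hBt, ← hM5, ← hN4]
    exact ⟨hrel', hrA', hfr'⟩

end SwapTransport

end Summit.ResolutionOfSingularities.ResolutionOfSingularities.Theorems.PIDim4

end
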